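import Summits.HubbardSuperconductivity.HubbardSuperconductivity.Theses.FluxSpectroscopy
import Literature.MathematicalPhysics.QuantumLattice.HubbardTorusFlux

/-!
# Birth skeleton (BC3) for crux `FluxSpectroscopy.FluxBridge` — stmt-HubbardSuperconductivity-1817

Route `route-HubbardSuperconductivity-FluxSpectroscopy` (sub-problem `HubbardSuperconductivity`), crux of
rank 2, THE FLUX BRIDGE (converse of Sewell 1990 / Nieh–Su–Zhao 1995 at `T = 0`, `d = 2`, canonical
sector): for all `U > 0`, `δ ∈ (0, 1/2)`, the flux criterion `FC_T(U, δ)` — an `O(1)` stiffness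
`E^T_L(θ) - E^T_L(0) ≥ ρ θ²` of the SECTOR-MINIMUM flux envelope on `|θ| ≤ π/2`, eventually in even `L` —
forces every admissible `(N_L, S^z = 0)` ground-state sequence `ψ_L` of `hubbardTorus 2 L 1 U` to carry,
eventually in even `L`, a unit EIGENVECTOR of Yang's `ρ₂(ψ_L) = twoParticleRDM (ψ L)` with eigenvalue
`≥ c N_L` (Yang ODLRO, eigenpair form).

Registrar seat `planner-skel-stmt-HubbardSuperconductivity-1817-0`, 2026-08-17 (mode skeleton-register,
re-audit bin REPAIRABLE). Published as `Cruxes/FluxBridge/Lines/birth.lean`.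

## The cut: ORDER PARAMETER first, SPECTRUM last

An energy hypothesis can only be turned into information about a ground state through correlation
functions of LOCAL operators (trial states, sum rules, infrared / Pitaevskii–Stringari bounds, duality
all produce two-point functions of a local pair field), whereas the crux concludes with a SPECTRAL
object (a macroscopic eigenpair of the `4L² × 4L²`-indexed Gram matrix `ρ₂`). The skeleton separates the
two and names the dictionary between them:

* `stub_stiffnessForcesLocalPairLRO : StiffnessForcesLocalPairLRO` — THE OPEN CORE (size XL; the physics).
  `FC_T(U, δ)` (stated over the NAMED envelope `Literature.MathematicalPhysics.QuantumLattice.fluxEnergy`,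
  which is the route's inline `let ET` by `rfl`, cf. `HubbardTorusFlux.lean`) forces, for every
  admissible ground-state sequence, LONG-RANGE ORDER OF A BOUNDED LOCAL PAIR FIELD: there are `c > 0`
  and a range `R` such that eventually in even `L` some pair wavefunction `φ_L` supported on pairs of
  orbitals at torus distance `≤ R` (`IsLocalPairWF L R φ`: `|φ_L| ≤ 1`, second site `=` first site `+ e`,
  `e ∈ box 2 R`) has `re (φ_L† ρ₂(ψ_L) φ_L) = ‖P_{φ_L} ψ_L‖² ≥ c L⁴` — i.e. `Σ_{x,y} ⟨Δ_x† Δ_y⟩ ≥ c L⁴`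
  for the local pair operators `Δ_x` encoded by `φ_L` (channel-blind: `s`, `d_{x²-y²}`, `d_{xy}`,
  extended, triplet or finite-momentum/PDW textures are all admissible, as the crux intends; only the
  route's later cruxes select the channel). This is the converse-Byers–Yang statement in the form an
  infrared-bound / abelian-duality / sum-rule argument would actually deliver it (the "infrared half"
  the route header leaves undecomposed). Why it might fail = why the crux might fail (stiff but
  uncondensed pair liquids at `T = 0`, `d = 2` are excluded by no theorem; LSY 2005 Ch. 5), plus one
  extra bet made explicit here: the condensate wavefunction of an `FC_T` ground state keeps a
  non-vanishing weight at bounded pair separation as `L → ∞` (true for any BCS-like or RVB-like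
  state at fixed `(U, δ)`, where the pair size is set by `(U, δ)` and not by `L`).
* `stub_localPairLRO_le_supRayleigh : LocalPairLRO_le_supRayleigh` — YANG'S DICTIONARY, local LRO ⇒
  ODLRO (size M, provable now; Yang 1962 §4, the direction "pair-field LRO implies a macroscopic
  eigenvalue", cf. the sub-problem Statement's docstring `‖φ_d‖² = 4L²`). For EVERY state `ψ` on the
  torus of side `L`, every range `R` and every local pair wavefunction `φ`:
  `re (φ† ρ₂(ψ) φ) ≤ 4 (2R+1)² L² · supRayleigh (ρ₂ ψ)`. Proof sketch: `ρ₂(ψ)` is a Gram matrix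
  (`PosSemidefTrace.twoParticleRDM_posSemidef`), so `re (φ† ρ₂ φ) = ‖φ‖² · (Rayleigh quotient of φ/‖φ‖)
  ≤ ‖φ‖² · supRayleigh` (`re_star_dotProduct_mulVec_le_supRayleigh`, and `supRayleigh ≥ 0`); and
  `‖φ‖² ≤ #supp φ ≤ (2L² orbitals) × (2 spins × #box 2 R sites) = 4(2R+1)²L²` (`card_box`,
  `FermionTorus.equivTorusSite`). Degenerate sides: `L = 0` gives `0 ≤ 0`.
* `stub_hermitianTopEigenpair : HermitianTopEigenpair` — RAYLEIGH–RITZ ATTAINMENT in eigenpair form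
  (size S/M, provable now; Horn–Johnson Thm 4.2.2(c), Reed–Simon XIII.1): a Hermitian matrix on a
  nonempty finite index type has a unit eigenvector whose (real) eigenvalue dominates any
  `b ≤ supRayleigh`. Proof sketch: `supRayleigh = eigenvalues₀ 0`
  (`Matrix.supRayleigh_eq_eigenvalues₀_zero_holds`) is attained at the `eigenvectorBasis` vector of the
  top index (`Matrix.IsHermitian.exists_re_dotProduct_mulVec_eq`, `Matrix.IsHermitian.mulVec_eigenvectorBasis`).
  This is exactly the step the crux's docstring alludes to ("eigenpair form so that the tail composes
  without the spectral theorem"): the spectral theorem is paid here, once, as a named stub.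

Composition `FluxBridge_of : S1 → S2 → S3 → FluxBridge` (hypotheses spelled `__Registered.stub_X`,
`rfl`-aliases keyed by the stub names, for the native skeleton audit) is proved below WITHOUT `sorry`:
unpack the route's `let`-bound `FCT`/`Hyp` (definitionally `FluxCriterion`/`Admissible`), get
`c, R` and the local pair field from S1, squeeze `c L⁴ ≤ re (φ† ρ₂ φ) ≤ 4(2R+1)² L² supRayleigh` (S2) to
`supRayleigh (ρ₂ ψ_L) ≥ c' L² ≥ c' N_L` with `c' = c / (4(2R+1)²)` and `N_L = 2⌊(1-δ)L²/2⌋ ≤ L²`, and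
extract the eigenpair with S3 (`ρ₂` Hermitian as a Gram matrix; the pair index type is inhabited for
`L ≥ 1`). It concludes the route decl
`Summit.HubbardSuperconductivity.HubbardSuperconductivity.Theses.FluxSpectroscopy.FluxBridge` BY NAME.

## Disproof used / negatives / dead lines

None relevant: `ledger crux ls stmt-HubbardSuperconductivity-1817` showed no workfiles (no
`Disproof.lean`, no `Lines/`, no ideas) on 2026-08-17; `ledger negatives --problem HubbardSuperconductivity`
lists two refuted statements (CooperPairDMottWalk breathing self-duality, AposterioriCapRg KLS openness),
neither about flux envelopes, `ρ₂` or ODLRO, and no stub is an instance of either. The in-content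
sibling `EatTheGoldstone.StiffnessForcesCondensation` (stmt-2243; extra `hc/2e`-periodicity hypothesis,
uniform gauge) is logically incomparable and is NOT used as a stub (its extra hypothesis does not
follow from `FC_T` by any landed theorem).

## BC3 audit (registrar folder `bc/`, 2026-08-17, farm `lean check --json`)

This file: rc 0, errors [], sorries 3 = the three `stub_*` (the three `declaration uses sorry` warnings
sit exactly at `stub_stiffnessForcesLocalPairLRO`, `stub_localPairLRO_le_supRayleigh`,
`stub_hermitianTopEigenpair`; zero elsewhere), `#print axioms FluxBridge_of` =
[propext, Classical.choice, Quot.sound] (no `sorryAx`). Probes (files `bc/birth_probe_S{1,2,3}.lean`,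
stub statements pasted as closed Props, no stub theorem and no composition in scope, every example under
`set_option maxHeartbeats 400000`): for every stub `S ∈ {StiffnessForcesLocalPairLRO,
LocalPairLRO_le_supRayleigh, HermitianTopEigenpair}` both `S → FluxBridge` and
`S → _root_.HubbardSuperconductivity` by `first | exact? | simpa | aesop` (payload form) and by
`first | exact? | simpa [S] | (unfold S; simpa) | aesop` (BC.md form) FAIL — 12/12: against the crux
the combined tactic exhausts the 400 000 heartbeats in `whnf`; against the summit `exact?`/`simpa` fail
and `aesop` "failed to prove the goal after exhaustive search". For the load-bearing stub the
alternatives were also run one at a time (`bc/birth_probe_S1_split.lean`): `exact?` — heartbeat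
exhaustion on `S1 → FluxBridge`, "could not close the goal" on `S1 → HubbardSuperconductivity`;
`simpa` — "Tactic `assumption` failed"; `aesop` — "failed to prove the goal after exhaustive search";
`intro h; exact?` — heartbeat exhaustion. No stub is cheaply the crux or the summit (details:
`Cruxes/FluxBridge/BC3-probes.md`).

## References

Yang, Rev. Mod. Phys. 34 (1962) 694, §4 [Yang1962]; Sewell, J. Stat. Phys. 61 (1990) 415 [Sewell1990];
Nieh–Su–Zhao, PRB 51 (1995) 3760 [NiehSuZhao1995]; Byers–Yang, PRL 7 (1961) 46 [ByersYang1961];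
Scalapino–White–Zhang, PRB 47 (1993) 7995 [ScalapinoWhiteZhang1993]; Lieb–Seiringer–Solovej–Yngvason,
*The Mathematics of the Bose Gas* (2005) Ch. 5 [LiebSeiringerSolovejYngvason2005]; Gunther–Imry, Solid
State Commun. 7 (1969) 1391 [GuntherImry1969]; Horn–Johnson, *Matrix Analysis* (2013) Thm 4.2.2
[HornJohnson2013]; Pitaevskii–Stringari, J. Low Temp. Phys. 85 (1991) 377 (uncertainty-relation route
from stiffness to order-parameter bounds at `T = 0`).
-/

-- `Summit.<Summit>.<Problem>` is the tree's mandated summit-side namespace; single-conjunct summit, duplicate deliberate.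
set_option linter.dupNamespace false

noncomputable section

namespace Summit.HubbardSuperconductivity.HubbardSuperconductivity.Cruxes.FluxBridge.Birth

open Filter Matrix
open Literature.Probability.LatticeModels
open Literature.MathematicalPhysics.QuantumLattice
open scoped ComplexOrder

/-! ## Objects -/

/-- Pair wavefunctions (geminal coefficient vectors, the index of Yang's `ρ₂`) on the fermionic torus
of side `L`: functions of an ordered pair of Hubbard orbitals `(site, spin)`. -/
abbrev PairWF (L : ℕ) : Type := Orb (FermionTorus 2 L) × Orb (FermionTorus 2 L) → ℂ

/-- **The flux criterion `FC_T(U, δ)`** of the route, over the NAMED flux envelope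
`fluxEnergy L U δ θ = E^T_L(U, δ; θ)` (sector minimum of the seam-twisted torus; the route's inline
`let ET` is this term by `rfl`): `∃ ρ > 0`, eventually in even `L`,
`ρ θ² ≤ E^T_L(θ) - E^T_L(0)` for all `|θ| ≤ π/2`. -/
def FluxCriterion (U δ : ℝ) : Prop :=
  ∃ ρ : ℝ, 0 < ρ ∧ ∀ᶠ L : ℕ in atTop, ∀ [NeZero L], Even L → ∀ θ : ℝ, |θ| ≤ Real.pi / 2 →
    ρ * θ ^ 2 ≤ fluxEnergy L U δ θ - fluxEnergy L U δ 0

/-- **Admissible ground-state sequences** (the route's `Hyp`, verbatim = the summit hypothesis): at every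
even side, `N_L = 2⌊(1-δ)L²/2⌋` electrons, `ψ_L` normalised, and `ψ_L` a ground state of
`hubbardTorus 2 L 1 U` in the sector `(N_L, S^z = 0)`. -/
def Admissible (U δ : ℝ) (N : ℕ → ℕ) (ψ : ∀ L : ℕ, Fock (Orb (FermionTorus 2 L))) : Prop :=
  ∀ L, Even L → N L = 2 * ⌊(1 - δ) * (L : ℝ) ^ 2 / 2⌋₊ ∧ star (ψ L) ⬝ᵥ ψ L = 1 ∧
    IsGroundStateInSector (hubbardTorus 2 L 1 U) (N L) 0 (ψ L)

/-- **Local (range-`R`, sup-bounded) pair wavefunctions**: `|φ p| ≤ 1` everywhere, and `φ (o₁, o₂) ≠ 0`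
only if the site of `o₂` is the site of `o₁` translated by some `e ∈ {-R, …, R}²` on the torus
(`Torus.proj`). These are the coefficient vectors of sums `Σ_x Δ_x` of bounded local pair operators
(any spin structure, any form factor of range `≤ R`, any site-dependent phase texture). -/
def IsLocalPairWF (L R : ℕ) (φ : PairWF L) : Prop :=
  (∀ p, ‖φ p‖ ≤ 1) ∧
    ∀ p, φ p ≠ 0 → ∃ e ∈ box 2 R,
      (ofLex p.2).1.toTorusSite = (ofLex p.1).1.toTorusSite + Torus.proj L e

/-! ## Stub statements -/

/-- **S1 — stiffness forces long-range order of a bounded local pair field** (the open core).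
For all `U > 0`, `δ ∈ (0, 1/2)` with `FC_T(U, δ)` and every admissible ground-state sequence there are
`c > 0` and a range `R` such that, eventually in even `L`, some range-`R` local pair wavefunction `φ`
with `|φ| ≤ 1` has `c L⁴ ≤ re (φ† ρ₂(ψ_L) φ) = ‖P_φ ψ_L‖²`. -/
def StiffnessForcesLocalPairLRO : Prop :=
  ∀ U δ : ℝ, 0 < U → δ ∈ Set.Ioo (0 : ℝ) (1 / 2) → FluxCriterion U δ →
    ∀ (N : ℕ → ℕ) (ψ : ∀ L : ℕ, Fock (Orb (FermionTorus 2 L))), Admissible U δ N ψ →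
      ∃ c : ℝ, 0 < c ∧ ∃ R : ℕ, ∀ᶠ L : ℕ in atTop, Even L →
        ∃ φ : PairWF L, IsLocalPairWF L R φ ∧
          c * (L : ℝ) ^ 4 ≤ (star φ ⬝ᵥ (twoParticleRDM (ψ L) *ᵥ φ)).re

/-- **S2 — Yang's dictionary, local pair-field LRO ⇒ macroscopic Rayleigh quotient** (provable now).
For every side `L`, range `R`, Fock vector `ψ` and local pair wavefunction `φ`:
`re (φ† ρ₂(ψ) φ) ≤ 4 (2R+1)² L² · supRayleigh (ρ₂ ψ)` (`‖φ‖² ≤ #supp φ ≤ 4(2R+1)²L²`, `ρ₂ ⪰ 0`). -/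
def LocalPairLRO_le_supRayleigh : Prop :=
  ∀ (L R : ℕ) (ψ : Fock (Orb (FermionTorus 2 L))) (φ : PairWF L), IsLocalPairWF L R φ →
    (star φ ⬝ᵥ (twoParticleRDM ψ *ᵥ φ)).re ≤
      4 * ((2 * R + 1 : ℕ) : ℝ) ^ 2 * (L : ℝ) ^ 2 * (twoParticleRDM ψ).supRayleigh

/-- **S3 — Rayleigh–Ritz attainment, eigenpair form** (provable now). A Hermitian matrix on a nonempty
finite index type has, for every `b ≤ supRayleigh ρ`, a unit eigenvector with real eigenvalue `ev ≥ b`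
(take the top vector of an orthonormal eigenbasis: its eigenvalue is `eigenvalues₀ 0 = supRayleigh ρ`). -/
def HermitianTopEigenpair : Prop :=
  ∀ {m : Type} [Fintype m] [Nonempty m] (ρ : Matrix m m ℂ), ρ.IsHermitian →
    ∀ b : ℝ, b ≤ ρ.supRayleigh →
      ∃ v : m → ℂ, ∃ ev : ℝ, star v ⬝ᵥ v = 1 ∧ ρ *ᵥ v = (ev : ℂ) • v ∧ b ≤ ev

/-! ## Registered stubs -/

/-- stub S1: stiffness forces LRO of a bounded local pair field (hardest stub; the open core of the crux). -/
theorem stub_stiffnessForcesLocalPairLRO : StiffnessForcesLocalPairLRO := by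
  sorry

/-- stub S2: Yang's dictionary, local pair-field LRO ⇒ large `supRayleigh (ρ₂)` (provable now). -/
theorem stub_localPairLRO_le_supRayleigh : LocalPairLRO_le_supRayleigh := by
  sorry

/-- stub S3: Rayleigh–Ritz attainment in eigenpair form (provable now). -/
theorem stub_hermitianTopEigenpair : HermitianTopEigenpair := by
  sorry

/-! ## Name-keyed aliases of the stub statements — the hypotheses of `FluxBridge_of`

The native skeleton audit (`#h21_check_skeleton`) admits a hypothesis of the skeleton theorem only if its
head constant is a registered obligation or is NAMED like a declared stub; `__Registered.stub_X` is the
statement of `stub_X` under that name (device of `Cruxes/AmplitudeLDP/Lines/birth.lean` in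
`AtomisticToContinuum/BoseEinsteinCondensation`). Each alias is `rfl`-equal to its statement. -/
namespace __Registered

/-- Alias of `StiffnessForcesLocalPairLRO` keyed by the registered stub name. -/
abbrev stub_stiffnessForcesLocalPairLRO : Prop := StiffnessForcesLocalPairLRO
/-- Alias of `LocalPairLRO_le_supRayleigh` keyed by the registered stub name. -/
abbrev stub_localPairLRO_le_supRayleigh : Prop := LocalPairLRO_le_supRayleigh
/-- Alias of `HermitianTopEigenpair` keyed by the registered stub name. -/
abbrev stub_hermitianTopEigenpair : Prop := HermitianTopEigenpair

end __Registered

/-! ## Composition: the crux BY NAME from the three stub statements (no `sorry` below) -/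

/-- **FluxBridge_of** — local order (S1) × Yang's dictionary (S2) × Rayleigh–Ritz (S3) ⟹ `FluxBridge`.
Hypotheses = the three stub statements under their registered names (`__Registered.stub_X` is `X` by
`rfl`); conclusion = the route decl, by name. -/
theorem FluxBridge_of (hA : __Registered.stub_stiffnessForcesLocalPairLRO)
    (hB : __Registered.stub_localPairLRO_le_supRayleigh)
    (hC : __Registered.stub_hermitianTopEigenpair) :
    Summit.HubbardSuperconductivity.HubbardSuperconductivity.Theses.FluxSpectroscopy.FluxBridge := by
  classical
  intro U δ hU hδ hFC N ψ hHyp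
  -- the route's `let`-bound `FCT U δ` / `Hyp U δ N ψ` are `FluxCriterion U δ` / `Admissible U δ N ψ`
  -- definitionally (`fluxEnergy` unfolds to the inline seam-twisted sector minimum)
  have hFC' : FluxCriterion U δ := hFC
  have hHyp' : Admissible U δ N ψ := hHyp
  -- (S1) the local pair field and its long-range order
  obtain ⟨c, hc, R, hev⟩ := hA U δ hU hδ hFC' N ψ hHyp'
  have hKpos : (0 : ℝ) < 4 * ((2 * R + 1 : ℕ) : ℝ) ^ 2 := by positivity
  refine ⟨c / (4 * ((2 * R + 1 : ℕ) : ℝ) ^ 2), div_pos hc hKpos, ?_⟩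
  filter_upwards [hev] with L hL
  intro hL0 hEven
  obtain ⟨φ, hφ, hlow⟩ := hL hEven
  -- (S2) squeeze: `c L⁴ ≤ re (φ† ρ₂ φ) ≤ 4(2R+1)² L² · supRayleigh`
  have hup := hB L R (ψ L) φ hφ
  have hLpos : (0 : ℝ) < (L : ℝ) := Nat.cast_pos.mpr (Nat.pos_of_ne_zero (NeZero.ne L))
  have hL2 : (0 : ℝ) < (L : ℝ) ^ 2 := by positivity
  have hsup : c / (4 * ((2 * R + 1 : ℕ) : ℝ) ^ 2) * (L : ℝ) ^ 2 ≤
      (twoParticleRDM (ψ L)).supRayleigh := by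
    rw [div_mul_eq_mul_div, div_le_iff₀ hKpos]
    have h1 : c * (L : ℝ) ^ 4 ≤
        4 * ((2 * R + 1 : ℕ) : ℝ) ^ 2 * (L : ℝ) ^ 2 * (twoParticleRDM (ψ L)).supRayleigh :=
      hlow.trans hup
    have h2 : (c * (L : ℝ) ^ 2) * (L : ℝ) ^ 2 ≤
        ((twoParticleRDM (ψ L)).supRayleigh * (4 * ((2 * R + 1 : ℕ) : ℝ) ^ 2)) * (L : ℝ) ^ 2 := by
      calc (c * (L : ℝ) ^ 2) * (L : ℝ) ^ 2 = c * (L : ℝ) ^ 4 := by ring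
        _ ≤ _ := h1
        _ = _ := by ring
    exact le_of_mul_le_mul_right h2 hL2
  -- density: `N_L = 2⌊(1-δ)L²/2⌋ ≤ L²`
  obtain ⟨hN, -, -⟩ := hHyp' L hEven
  have hNle : (N L : ℝ) ≤ (L : ℝ) ^ 2 := by
    have hy : (0 : ℝ) ≤ (1 - δ) * (L : ℝ) ^ 2 / 2 := by
      have : (0 : ℝ) ≤ 1 - δ := by linarith [hδ.2]
      positivity
    have hfl := Nat.floor_le hy
    have hδL : (0 : ℝ) ≤ δ * (L : ℝ) ^ 2 := by
      have := hδ.1.le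
      positivity
    rw [hN]
    push_cast
    nlinarith [hfl, hδL]
  have hb : c / (4 * ((2 * R + 1 : ℕ) : ℝ) ^ 2) * (N L : ℝ) ≤ (twoParticleRDM (ψ L)).supRayleigh :=
    le_trans (mul_le_mul_of_nonneg_left hNle (div_pos hc hKpos).le) hsup
  -- (S3) the eigenpair (`ρ₂` is Hermitian as a Gram matrix; the pair index type is inhabited)
  haveI : Nonempty (Orb (FermionTorus 2 L) × Orb (FermionTorus 2 L)) :=
    ⟨(orb (FermionTorus.ofTorusSite (0 : TorusSite 2 L)) 0,
      orb (FermionTorus.ofTorusSite (0 : TorusSite 2 L)) 0)⟩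
  obtain ⟨v, ev, hv, hveq, hge⟩ := hC (twoParticleRDM (ψ L))
    (PosSemidefTrace.twoParticleRDM_posSemidef (ψ L)).isHermitian _ hb
  exact ⟨v, ev, hv, hveq, hge⟩

/-- Wiring check (an `example`, so that `FluxBridge_of` stays the only theorem concluding the crux):
the registered stubs feed the skeleton theorem as stated — this term becomes the crux proof when the
three `sorry`s above are discharged (it carries `sorryAx` exactly through the three `stub_*`). -/
example : Summit.HubbardSuperconductivity.HubbardSuperconductivity.Theses.FluxSpectroscopy.FluxBridge :=
  FluxBridge_of stub_stiffnessForcesLocalPairLRO stub_localPairLRO_le_supRayleigh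
    stub_hermitianTopEigenpair

/-- The plain-arrow form `<stub sigs> → FluxBridge` of the skeleton theorem (same proof term). -/
example : StiffnessForcesLocalPairLRO → LocalPairLRO_le_supRayleigh → HermitianTopEigenpair →
    Summit.HubbardSuperconductivity.HubbardSuperconductivity.Theses.FluxSpectroscopy.FluxBridge :=
  FluxBridge_of

end Summit.HubbardSuperconductivity.HubbardSuperconductivity.Cruxes.FluxBridge.Birth

end
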